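import Literature.Analysis.FluidPDE.NSUniqueness2DL4
import Literature.Analysis.FluidPDE.NSGalerkinEnstrophy2D
import Literature.Analysis.FluidPDE.LerayHopfSpectralMeasurability
import Literature.Analysis.FluidPDE.NSHopfGalerkinLimit
import Literature.Analysis.FunctionSpaces.TorusEnstrophyOrthogonality
import Literature.Analysis.FunctionSpaces.TorusFourierSeries
import HarnessLib

/-!
# The trilinear term against the truncated Stokes operator on `𝕋²`:
  `b(v, A P_N v, v) → 0` for `v ∈ H²` (support file of the 2-D enstrophy balance)

Trunk: FluidKinetic. In the a posteriori derivation of the enstrophy equation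
`½ d/dt‖∇u‖² + ν‖Δu‖² = (f, Au)` of a two-dimensional Leray–Hopf solution with
`u ∈ L^∞(0,T;V) ∩ L²(0,T;D(A))` (Foias–Manley–Rosa–Temam 2001, App. II.A (A.65); Remark 7.1:
"obtained by replacing `v` by `Au` in (7.1)"), the weak formulation can only be tested against
the *truncated* Stokes operator `A P_N u = -Δ P_N u` (a smooth divergence-free trigonometric
polynomial); the trilinear term that appears is `∫ ⟪u, (u·∇) ΔP_N u⟫`, and one has to show that
it tends to zero as `N → ∞`, which is where the 2-D orthogonality (A.62) `b(v,v,Av) = 0` enters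
for NON-smooth `v ∈ D(A)` ("for all vector fields in `D(A)`", op. cit. p. 118). This file proves
the quantitative form of that statement, slice by slice:

* `Torus.latticeSumFour` — `∑_{k ∈ ℤ² ∖ 0} |k|⁻⁴ < ∞`, and the Wiener-algebra bound
  `∑_{k∈S∖0} ‖c k‖ ≤ √Σ₄ (∑_{k∈S} |k|⁴‖c k‖²)^{1/2}` (Cauchy–Schwarz), whence the **sup bound of
  truncations of `H²` fields** `‖P_M v(x)‖ ≤ ‖v̂(0)‖ + √Σ₄ (‖Δv‖₂²/16π⁴)^{1/2}`
  (`Torus.norm_fourierTruncate_apply_le`; Agmon/Sobolev `H²(𝕋²) ⊂ C⁰`, FMRT (A.48) in a crude form);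
* `Torus.tailLaplacianNormSq N v = 16π⁴ ∑_{|k|>N} |k|⁴‖v̂(k)‖²`, `≤ ‖Δv‖₂²`, `→ 0`, and
  `∫ ‖ΔP_M v - ΔP_N v‖² ≤ tail_N` for `N ≤ M` (Parseval);
* `Torus.abs_integral_inner_convect_self_le` — for smooth `w` with `‖w‖ ≤ W` and `G ∈ L²`,
  `|∫⟪(w·∇)w, G⟫| ≤ W (#d ‖∇w‖₂²)^{1/2} ‖G‖₂` (pointwise `‖(w·∇)w‖ ≤ ‖w‖∑ᵢ‖∂ᵢw‖`, Cauchy–Schwarz,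
  `∑ᵢ∫‖∂ᵢw‖² = ‖∇w‖₂²`);
* `Torus.integral_inner_fourierTruncate_convect_laplacian_eq` (**𝕋²**) — for `v ∈ L²` weakly
  divergence free and `N ≤ M`, `∫⟪P_M v, (P_M v·∇)ΔP_N v⟫ = ∫⟪(P_M v·∇)P_M v, ΔP_M v - ΔP_N v⟫`:
  antisymmetry of the trilinear form and (A.62) for the smooth `P_M v`
  (`Torus.integral_inner_laplacian_convect_self_eq_zero`);
* `Torus.tendsto_integral_inner_fourierTruncate_convect` — `∫⟪P_M v,(P_M v·∇)Ψ⟫ → ∫⟪v,(v·∇)Ψ⟫`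
  (`P_M v → v` in `L²`, the pairing is `L²`-continuous for fixed smooth `Ψ`);
* `Torus.abs_integral_inner_convect_laplacian_fourierTruncate_le` (**𝕋²**, the result):
  for `v ∈ L²(𝕋²)` weakly divergence free with `‖∇v‖₂, ‖Δv‖₂ < ∞`,
  `|∫⟪v, (v·∇)ΔP_N v⟫| ≤ (‖v̂(0)‖ + √Σ₄(‖Δv‖₂²/16π⁴)^{1/2}) (2‖∇v‖₂²)^{1/2} (tail_N)^{1/2}`, which
  tends to `0` (`Torus.tendsto_integral_inner_convect_laplacian_fourierTruncate`).

## Mathlib / tree search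

Reused from the tree: `Torus.fourierTruncate` and its Parseval/Bessel lemmas (`TorusTrigPoly`),
`Torus.laplacian_realTrigPoly`, `Torus.norm_realTrigPoly_apply_le`, `Torus.norm_convect_le`
(`TorusFourierModes`), `Torus.sum_lintegral_enorm_sq_partialDeriv_eq_eGradNormSq`
(`NSUniqueness2DL4`), `Torus.integral_inner_convect_eq_neg`, (A.62)
`Torus.integral_inner_laplacian_convect_self_eq_zero`, the lattice sums of `TorusFourierSeries`
(`summable_inv_one_add_freqNormSq_pow_card`). From Mathlib: Hölder
`integral_mul_norm_le_Lp_mul_Lq`, `sq_sum_le_card_mul_sum_sq`, `sum_mul_sq_le_sq_mul_sq`,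
`ENNReal.tendsto_tsum_compl_atTop_zero`.

## References

* C. Foias, O. Manley, R. Rosa, R. Temam, *Navier–Stokes Equations and Turbulence*, CUP 2001,
  Ch. II Remark 7.1 (PDF p. 73); App. II.A (A.48), (A.62), (A.65) (PDF pp. 116–118).
* R. Temam, *Navier–Stokes Equations and Nonlinear Functional Analysis*, 2nd ed., SIAM 1995,
  Part I §3, Lemma 3.1 (`b(u,u,Au) = 0`, space-periodic case, `n = 2`).
-/

noncomputable section

open MeasureTheory TopologicalSpace Set Function Filter Topology UnitAddTorus
open scoped InnerProductSpace RealInnerProductSpace ENNReal NNReal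

namespace Literature.Analysis.FluidPDE.Torus

open FunctionSpaces FunctionSpaces.Torus

variable {d : Type*} [Fintype d]

/-! ### Truncations: composition, Laplacian, tails -/

section Truncation

variable [DecidableEq d]

/-- Truncating twice: `P_N (P_M v) = P_N v` for `N ≤ M` (the coefficients of `P_M v` on the
ball of radius `N` are those of `v`). [folklore] -/
theorem fourierTruncate_fourierTruncate {v : UnitAddTorus d → EuclideanSpace ℝ d}
    (hv : Integrable v volume) {N M : ℕ} (hNM : N ≤ M) :
    fourierTruncate N (fourierTruncate M v) = fourierTruncate N v := by
  rw [fourierTruncate_eq N (fourierTruncate M v), fourierTruncate_eq N v]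
  refine realTrigPoly_congr fun k hk => ?_
  rw [mFourierCoeff_fourierTruncate hv, if_pos (freqBall_mono hNM hk)]

omit [DecidableEq d] in
/-- The coefficients `k ↦ -4π²|k|² v̂(k)` of the Laplacian of a truncation. [folklore] -/
theorem laplacian_fourierTruncate_apply [DecidableEq d] (v : UnitAddTorus d → EuclideanSpace ℝ d)
    (N : ℕ) (x : UnitAddTorus d) :
    laplacian (fourierTruncate N v) x = realTrigPoly (freqBall N)
      (fun k => -(((4 * Real.pi ^ 2 * freqNormSq k : ℝ) : ℂ) •
        mFourierCoeff (EuclideanSpace.complexify ∘ v) k)) x := by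
  rw [fourierTruncate_eq, laplacian_realTrigPoly]

/-- **The tail of the palinstrophy beyond the ball of radius `N`**:
`16π⁴ ∑_{|k| > N} |k|⁴ ‖v̂(k)‖² ∈ [0, ∞]`. [folklore] -/
def tailLaplacianNormSq (N : ℕ) (v : UnitAddTorus d → EuclideanSpace ℝ d) : ℝ≥0∞ :=
  ENNReal.ofReal (16 * Real.pi ^ 4) * ∑' k : d → ℤ,
    if k ∈ freqBall N then 0 else
      ENNReal.ofReal (freqNormSq k ^ (2 : ℝ)) * ‖mFourierCoeff (EuclideanSpace.complexify ∘ v) k‖ₑ ^ 2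

omit [DecidableEq d] in
/-- The palinstrophy as the same series without the cut-off (the zero mode has weight `0`). [folklore] -/
theorem eLaplacianNormSq_eq_tsum' [DecidableEq d] (v : UnitAddTorus d → EuclideanSpace ℝ d) :
    eLaplacianNormSq v = ENNReal.ofReal (16 * Real.pi ^ 4) * ∑' k : d → ℤ,
      ENNReal.ofReal (freqNormSq k ^ (2 : ℝ)) * ‖mFourierCoeff (EuclideanSpace.complexify ∘ v) k‖ₑ ^ 2 := by
  rw [eLaplacianNormSq, eHomSobolevSeminorm_two_sq_eq_tsum']
  congr 1
  refine tsum_congr fun k => ?_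
  by_cases hk : k = 0
  · subst hk; simp [freqNormSq_zero]
  · rw [if_neg hk]

/-- The tail is at most the whole palinstrophy. [folklore] -/
theorem tailLaplacianNormSq_le (N : ℕ) (v : UnitAddTorus d → EuclideanSpace ℝ d) :
    tailLaplacianNormSq N v ≤ eLaplacianNormSq v := by
  rw [tailLaplacianNormSq, eLaplacianNormSq_eq_tsum']
  refine mul_le_mul_right (ENNReal.tsum_le_tsum fun k => ?_) _
  split_ifs
  · exact bot_le
  · exact le_rfl

/-- **The tail tends to zero** when the palinstrophy is finite (tails of a convergent series;
`Torus.tendsto_freqBall_atTop`). [folklore] -/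
theorem tendsto_tailLaplacianNormSq {v : UnitAddTorus d → EuclideanSpace ℝ d}
    (hv : eLaplacianNormSq v ≠ ⊤) :
    Tendsto (fun N => tailLaplacianNormSq N v) atTop (𝓝 0) := by
  set g : (d → ℤ) → ℝ≥0∞ := fun k =>
    ENNReal.ofReal (freqNormSq k ^ (2 : ℝ)) * ‖mFourierCoeff (EuclideanSpace.complexify ∘ v) k‖ₑ ^ 2 with hg
  have hsum : ∑' k, g k ≠ ⊤ := by
    intro h
    apply hv
    rw [eLaplacianNormSq_eq_tsum', h, ENNReal.mul_top]
    have : (0 : ℝ) < 16 * Real.pi ^ 4 := by positivity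
    simpa using this
  have htail := (ENNReal.tendsto_tsum_compl_atTop_zero hsum).comp tendsto_freqBall_atTop
  have heq : ∀ s : Finset (d → ℤ), (∑' b : {x // x ∉ s}, g b) = ∑' k, if k ∈ s then 0 else g k := by
    intro s
    have h := tsum_subtype ({x | x ∉ s} : Set (d → ℤ)) g
    refine h.trans (tsum_congr fun k => ?_)
    by_cases hk : k ∈ s
    · rw [if_pos hk, Set.indicator_of_notMem (by simpa using hk)]
    · rw [if_neg hk, Set.indicator_of_mem (by simpa using hk)]
  have h0 : (0 : ℝ≥0∞) = ENNReal.ofReal (16 * Real.pi ^ 4) * 0 := by rw [mul_zero]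
  rw [h0]
  refine (ENNReal.Tendsto.const_mul htail (Or.inr ENNReal.ofReal_ne_top)).congr fun N => ?_
  rw [tailLaplacianNormSq, Function.comp_apply, heq]

/-- **The Laplacians of two truncations differ by the tail**: for integrable `v` and `N ≤ M`,
`∫⁻ ‖ΔP_M v - ΔP_N v‖ₑ² ≤ 16π⁴ ∑_{|k|>N} |k|⁴‖v̂(k)‖²` (Parseval for the trigonometric polynomial
`ΔP_M v - ΔP_N v`, whose coefficients are `-4π²|k|² v̂(k)` for `N < |k| ≤ M` and `0` otherwise). [folklore] -/
theorem lintegral_enorm_sq_laplacian_fourierTruncate_sub {v : UnitAddTorus d → EuclideanSpace ℝ d}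
    (hv : Integrable v volume) {N M : ℕ} (hNM : N ≤ M) :
    ∫⁻ x, ‖laplacian (fourierTruncate M v) x - laplacian (fourierTruncate N v) x‖ₑ ^ 2 ≤
      tailLaplacianNormSq N v := by
  set a : (d → ℤ) → EuclideanSpace ℂ d := fun k =>
    -(((4 * Real.pi ^ 2 * freqNormSq k : ℝ) : ℂ) • mFourierCoeff (EuclideanSpace.complexify ∘ v) k) with ha
  set c : (d → ℤ) → EuclideanSpace ℂ d := fun k => if k ∈ freqBall N then 0 else a k with hc
  have ha_symm : IsConjSymm a := isConjSymm_laplacianCoeff (isConjSymm_mFourierCoeff hv)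
  have hc_symm : IsConjSymm c := by
    intro k
    simp only [hc, neg_mem_freqBall]
    split_ifs
    · exact (EuclideanSpace.conjVec_zero).symm
    · exact ha_symm k
  -- the difference is one trigonometric polynomial on the big ball
  have hdiff : ∀ x, laplacian (fourierTruncate M v) x - laplacian (fourierTruncate N v) x =
      realTrigPoly (freqBall M) c x := by
    intro x
    rw [laplacian_fourierTruncate_apply, laplacian_fourierTruncate_apply]
    have h1 : realTrigPoly (freqBall N) a = realTrigPoly (freqBall M) (fun k => if k ∈ freqBall N then a k else 0) := by
      rw [realTrigPoly_eq_comp, realTrigPoly_eq_comp, trigPoly_subset (freqBall_mono hNM)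
        (c := fun k => if k ∈ freqBall N then a k else 0) (fun k _ hk => if_neg hk)]
      congr 1
      exact trigPoly_congr fun k hk => (if_pos hk).symm
    have h2 : c = a - fun k => if k ∈ freqBall N then a k else 0 := by
      funext k; simp only [hc, Pi.sub_apply]; split_ifs <;> simp
    rw [h1, h2, realTrigPoly_sub]
    rfl
  simp_rw [hdiff]
  rw [lintegral_enorm_sq_eq_ofReal (memLp_realTrigPoly _ _ 2),
    integral_norm_sq_realTrigPoly neg_mem_freqBall_of_mem hc_symm, tailLaplacianNormSq,
    ENNReal.ofReal_sum_of_nonneg fun k _ => sq_nonneg _]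
  -- compare the finite sum with the series
  have hterm : ∀ k ∈ freqBall M, ENNReal.ofReal (‖c k‖ ^ 2) ≤ ENNReal.ofReal (16 * Real.pi ^ 4) *
      (if k ∈ freqBall N then 0 else
        ENNReal.ofReal (freqNormSq k ^ (2 : ℝ)) * ‖mFourierCoeff (EuclideanSpace.complexify ∘ v) k‖ₑ ^ 2) := by
    intro k _
    simp only [hc]
    split_ifs with hk
    · simp
    · rw [ha]
      dsimp only
      have hq : 0 ≤ freqNormSq k := freqNormSq_nonneg k
      rw [norm_neg, norm_smul, mul_pow, Complex.norm_real, Real.norm_eq_abs,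
        abs_of_nonneg (by positivity), Real.rpow_two, ← ofReal_norm, ← ENNReal.ofReal_pow (norm_nonneg _),
        ← ENNReal.ofReal_mul (sq_nonneg _), ← ENNReal.ofReal_mul (by positivity)]
      refine ENNReal.ofReal_le_ofReal (le_of_eq ?_)
      ring
  calc ∑ k ∈ freqBall M, ENNReal.ofReal (‖c k‖ ^ 2)
      ≤ ∑ k ∈ freqBall M, ENNReal.ofReal (16 * Real.pi ^ 4) *
          (if k ∈ freqBall N then 0 else
            ENNReal.ofReal (freqNormSq k ^ (2 : ℝ)) * ‖mFourierCoeff (EuclideanSpace.complexify ∘ v) k‖ₑ ^ 2) :=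
        Finset.sum_le_sum hterm
    _ = ENNReal.ofReal (16 * Real.pi ^ 4) * ∑ k ∈ freqBall M,
          (if k ∈ freqBall N then 0 else
            ENNReal.ofReal (freqNormSq k ^ (2 : ℝ)) * ‖mFourierCoeff (EuclideanSpace.complexify ∘ v) k‖ₑ ^ 2) := by
        rw [Finset.mul_sum]
    _ ≤ _ := mul_le_mul_right (ENNReal.sum_le_tsum _) _

end Truncation

/-! ### The Wiener bound on `𝕋²`: `∑ ‖v̂(k)‖ ≤ ‖v̂(0)‖ + √Σ₄ (∑|k|⁴‖v̂(k)‖²)^{1/2}` -/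

section Wiener

/-- **`∑_{k ∈ ℤ² ∖ 0} |k|⁻⁴ < ∞`** (comparison with `4 ((1+|k|²)²)⁻¹`, summable on `ℤ²` by the
product trick of `Torus.summable_inv_one_add_freqNormSq_pow_card`). [folklore] -/
theorem summable_inv_freqNormSq_sq :
    Summable (fun k : Fin 2 → ℤ => if k = 0 then (0 : ℝ) else (freqNormSq k ^ 2)⁻¹) := by
  refine Summable.of_nonneg_of_le (fun k => ?_) (fun k => ?_)
    ((summable_inv_one_add_freqNormSq_pow_card (d := Fin 2)).mul_left 4)
  · split_ifs
    · exact le_rfl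
    · exact inv_nonneg.2 (sq_nonneg _)
  · simp only [Fintype.card_fin]
    split_ifs with hk
    · have := freqNormSq_nonneg k; positivity
    · have h1 : 1 ≤ freqNormSq k := one_le_freqNormSq hk
      have hq : 0 < 4 * freqNormSq k ^ 2 := by positivity
      have h2 : (1 + freqNormSq k) ^ 2 ≤ 4 * freqNormSq k ^ 2 := by nlinarith
      calc (freqNormSq k ^ 2)⁻¹ = 4 * (4 * freqNormSq k ^ 2)⁻¹ := by
            rw [mul_inv, ← mul_assoc, mul_inv_cancel₀ (by norm_num : (4 : ℝ) ≠ 0), one_mul]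
        _ ≤ 4 * ((1 + freqNormSq k) ^ 2)⁻¹ := by
            gcongr 4 * ?_
            exact inv_anti₀ (by positivity) h2

/-- **The lattice constant** `Σ₄ = ∑_{k ∈ ℤ² ∖ 0} |k|⁻⁴`. [folklore] -/
def latticeSumFour : ℝ := ∑' k : Fin 2 → ℤ, if k = 0 then (0 : ℝ) else (freqNormSq k ^ 2)⁻¹

/-- `Σ₄ ≥ 0`. [folklore] -/
theorem latticeSumFour_nonneg : 0 ≤ latticeSumFour :=
  tsum_nonneg fun k => by
    split_ifs
    · exact le_rfl
    · exact inv_nonneg.2 (sq_nonneg _)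

/-- Partial sums of `|k|⁻⁴` over non-zero frequencies are bounded by `Σ₄`. [folklore] -/
theorem sum_inv_freqNormSq_sq_le (S : Finset (Fin 2 → ℤ)) :
    ∑ k ∈ S.erase 0, (freqNormSq k ^ 2)⁻¹ ≤ latticeSumFour := by
  have h := summable_inv_freqNormSq_sq.sum_le_tsum (S.erase 0) fun k _ => by
    split_ifs
    · exact le_rfl
    · exact inv_nonneg.2 (sq_nonneg _)
  refine le_trans (le_of_eq (Finset.sum_congr rfl fun k hk => ?_)) h
  rw [if_neg (Finset.ne_of_mem_erase hk)]

/-- **The Wiener bound (Cauchy–Schwarz)**: for any coefficient family `c` on `ℤ²` and finite `S`,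
`∑_{k∈S∖0} ‖c k‖ ≤ √Σ₄ · (∑_{k∈S} |k|⁴ ‖c k‖²)^{1/2}`. [folklore] -/
theorem sum_norm_le_sqrt_latticeSumFour_mul {E : Type*} [SeminormedAddCommGroup E]
    (S : Finset (Fin 2 → ℤ)) (c : (Fin 2 → ℤ) → E) :
    ∑ k ∈ S.erase 0, ‖c k‖ ≤
      Real.sqrt latticeSumFour * Real.sqrt (∑ k ∈ S, freqNormSq k ^ 2 * ‖c k‖ ^ 2) := by
  have hsplit : ∀ k ∈ S.erase 0, ‖c k‖ = (freqNormSq k)⁻¹ * (freqNormSq k * ‖c k‖) := by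
    intro k hk
    have h1 : freqNormSq k ≠ 0 :=
      (lt_of_lt_of_le one_pos (one_le_freqNormSq (Finset.ne_of_mem_erase hk))).ne'
    field_simp
  rw [Finset.sum_congr rfl hsplit]
  have hCS := Finset.sum_mul_sq_le_sq_mul_sq (S.erase 0) (fun k => (freqNormSq k)⁻¹)
    (fun k => freqNormSq k * ‖c k‖)
  have hA : ∑ k ∈ S.erase 0, ((freqNormSq k)⁻¹) ^ 2 ≤ latticeSumFour := by
    refine le_trans (le_of_eq (Finset.sum_congr rfl fun k _ => ?_)) (sum_inv_freqNormSq_sq_le S)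
    rw [inv_pow]
  have hB : ∑ k ∈ S.erase 0, (freqNormSq k * ‖c k‖) ^ 2 ≤ ∑ k ∈ S, freqNormSq k ^ 2 * ‖c k‖ ^ 2 := by
    refine (Finset.sum_le_sum_of_subset_of_nonneg (Finset.erase_subset 0 S) fun k _ _ => sq_nonneg _).trans
      (le_of_eq (Finset.sum_congr rfl fun k _ => by ring))
  have hL : 0 ≤ ∑ k ∈ S.erase 0, (freqNormSq k)⁻¹ * (freqNormSq k * ‖c k‖) :=
    Finset.sum_nonneg fun k _ => mul_nonneg (inv_nonneg.2 (freqNormSq_nonneg k))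
      (mul_nonneg (freqNormSq_nonneg k) (norm_nonneg _))
  rw [← Real.sqrt_mul latticeSumFour_nonneg, ← Real.sqrt_sq hL]
  exact Real.sqrt_le_sqrt (hCS.trans (mul_le_mul hA hB (Finset.sum_nonneg fun k _ => sq_nonneg _)
    latticeSumFour_nonneg))

/-- **Sup bound of truncations of `H²` fields on `𝕋²`** (the Wiener algebra bound behind Agmon's
inequality, FMRT 2001, App. II.A (A.48), in the crude form that suffices here): for an integrable
`v` with `‖Δv‖₂ < ∞`,
`‖P_M v(x)‖ ≤ ‖v̂(0)‖ + √Σ₄ (‖Δv‖₂² / 16π⁴)^{1/2}` for every `M` and `x`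
(`‖P_M v(x)‖ ≤ ∑_{|k|≤M} ‖v̂(k)‖`, the Wiener bound, and `16π⁴∑|k|⁴‖v̂(k)‖² ≤ ‖Δv‖₂²`). [cite: FoiasManleyRosaTemam2001, App. II.A (A.48)] -/
theorem norm_fourierTruncate_apply_le {v : UnitAddTorus (Fin 2) → EuclideanSpace ℝ (Fin 2)}
    (hlap : eLaplacianNormSq v ≠ ⊤) (M : ℕ) (x : UnitAddTorus (Fin 2)) :
    ‖fourierTruncate M v x‖ ≤ ‖mFourierCoeff (EuclideanSpace.complexify ∘ v) 0‖ +
      Real.sqrt latticeSumFour * Real.sqrt ((eLaplacianNormSq v).toReal / (16 * Real.pi ^ 4)) := by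
  set c : (Fin 2 → ℤ) → EuclideanSpace ℂ (Fin 2) := fun k => mFourierCoeff (EuclideanSpace.complexify ∘ v) k
    with hc
  have h1 : ‖fourierTruncate M v x‖ ≤ ∑ k ∈ freqBall M, ‖c k‖ := norm_realTrigPoly_apply_le _ _ x
  rw [← Finset.add_sum_erase _ _ (zero_mem_freqBall M)] at h1
  refine h1.trans (add_le_add le_rfl ((sum_norm_le_sqrt_latticeSumFour_mul _ c).trans ?_))
  refine mul_le_mul_of_nonneg_left (Real.sqrt_le_sqrt ?_) (Real.sqrt_nonneg _)
  -- `∑_{|k|≤M} |k|⁴‖v̂(k)‖² ≤ ‖Δv‖₂² / 16π⁴`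
  rw [le_div_iff₀ (by positivity), mul_comm]
  have hsum : ENNReal.ofReal (16 * Real.pi ^ 4) * ∑ k ∈ freqBall M,
      ENNReal.ofReal (freqNormSq k ^ (2 : ℝ)) * ‖c k‖ₑ ^ 2 ≤ eLaplacianNormSq v := by
    rw [eLaplacianNormSq_eq_tsum']
    exact mul_le_mul_right (ENNReal.sum_le_tsum _) _
  have hfin : ENNReal.ofReal (16 * Real.pi ^ 4) * ∑ k ∈ freqBall M,
      ENNReal.ofReal (freqNormSq k ^ (2 : ℝ)) * ‖c k‖ₑ ^ 2 =
      ENNReal.ofReal (16 * Real.pi ^ 4 * ∑ k ∈ freqBall M, freqNormSq k ^ 2 * ‖c k‖ ^ 2) := by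
    rw [ENNReal.ofReal_mul (by positivity : (0:ℝ) ≤ 16 * Real.pi ^ 4),
      ENNReal.ofReal_sum_of_nonneg fun k _ => mul_nonneg (sq_nonneg _) (sq_nonneg _)]
    congr 1
    refine Finset.sum_congr rfl fun k _ => ?_
    rw [Real.rpow_two, ENNReal.ofReal_mul (sq_nonneg _), ← ofReal_norm, ← ENNReal.ofReal_pow (norm_nonneg _)]
  rw [hfin] at hsum
  have := ENNReal.toReal_mono hlap hsum
  rwa [ENNReal.toReal_ofReal (mul_nonneg (by positivity) (Finset.sum_nonneg fun k _ =>
    mul_nonneg (sq_nonneg _) (sq_nonneg _)))] at this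

end Wiener

/-! ### The trilinear term of a smooth field against an `L²` field -/

section Trilinear

omit [Fintype d] in
/-- Cauchy–Schwarz on a measure space in `L²` form: `∫ ‖f‖‖g‖ ≤ ‖f‖_{L²} ‖g‖_{L²}`. [folklore] -/
theorem integral_norm_mul_norm_le_toReal_eLpNorm {X : Type*} {m : MeasurableSpace X} {μ : Measure X}
    {E₁ E₂ : Type*} [NormedAddCommGroup E₁] [NormedAddCommGroup E₂] {f : X → E₁} {g : X → E₂}
    (hf : MemLp f 2 μ) (hg : MemLp g 2 μ) :
    ∫ x, ‖f x‖ * ‖g x‖ ∂μ ≤ (eLpNorm f 2 μ).toReal * (eLpNorm g 2 μ).toReal := by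
  have hfn : MemLp (fun x => ‖f x‖) (ENNReal.ofReal 2) μ := by rw [ENNReal.ofReal_ofNat]; exact hf.norm
  have hgn : MemLp (fun x => ‖g x‖) (ENNReal.ofReal 2) μ := by rw [ENNReal.ofReal_ofNat]; exact hg.norm
  have h := integral_mul_norm_le_Lp_mul_Lq (μ := μ) (f := fun x => ‖f x‖) (g := fun x => ‖g x‖)
    Real.HolderConjugate.two_two hfn hgn
  simp only [norm_norm] at h
  have hf' := hf.eLpNorm_eq_integral_rpow_norm two_ne_zero ENNReal.ofNat_ne_top
  have hg' := hg.eLpNorm_eq_integral_rpow_norm two_ne_zero ENNReal.ofNat_ne_top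
  rw [ENNReal.toReal_ofNat] at hf' hg'
  rw [hf', hg', ENNReal.toReal_ofReal (by positivity), ENNReal.toReal_ofReal (by positivity)]
  simpa only [one_div] using h

variable [DecidableEq d]

/-- The gradient mass of a smooth field as a real number:
`∑ᵢ ∫ ‖∂ᵢw‖² = (‖∇w‖₂²).toReal` (`Torus.sum_lintegral_enorm_sq_partialDeriv_eq_eGradNormSq`). [folklore] -/
theorem sum_integral_norm_sq_partialDeriv_eq_toReal {w : UnitAddTorus d → EuclideanSpace ℝ d}
    (hw : IsSmooth w) :
    ∑ i, ∫ x, ‖FunctionSpaces.Torus.partialDeriv i w x‖ ^ 2 = (eGradNormSq w).toReal := by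
  rw [← sum_lintegral_enorm_sq_partialDeriv_eq_eGradNormSq hw, ENNReal.toReal_sum fun i _ => ?_]
  · refine Finset.sum_congr rfl fun i _ => ?_
    rw [lintegral_enorm_sq_eq_ofReal ((hw.partialDeriv i).memLp 2), ENNReal.toReal_ofReal
      (integral_nonneg fun x => sq_nonneg _)]
  · rw [lintegral_enorm_sq_eq_ofReal ((hw.partialDeriv i).memLp 2)]
    exact ENNReal.ofReal_ne_top

/-- **The trilinear term of a bounded smooth field against an `L²` field**: for a smooth `w` on
`T^d` with `‖w(x)‖ ≤ W` and `G ∈ L²`,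
`|∫ ⟪(w·∇)w, G⟫| ≤ W (#d ‖∇w‖₂²)^{1/2} ‖G‖_{L²}`
(pointwise `‖(w·∇)w‖ ≤ ‖w‖ ∑ᵢ‖∂ᵢw‖`, Cauchy–Schwarz twice; Temam 1995, Part I §2.3, the
elementary estimates of `b`). [folklore] -/
theorem abs_integral_convect_self_inner_le {w : UnitAddTorus d → EuclideanSpace ℝ d}
    (hw : IsSmooth w) {G : UnitAddTorus d → EuclideanSpace ℝ d} (hG : MemLp G 2 volume) {W : ℝ}
    (hW : ∀ x, ‖w x‖ ≤ W) :
    |∫ x, ⟪FunctionSpaces.Torus.convect w w x, G x⟫| ≤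
      W * Real.sqrt (Fintype.card d * (eGradNormSq w).toReal) * (eLpNorm G 2 volume).toReal := by
  have hW0 : 0 ≤ W := (norm_nonneg _).trans (hW 0)
  obtain ⟨φ, hφ⟩ : ∃ φ : UnitAddTorus d → ℝ, φ = fun x => ∑ i, ‖FunctionSpaces.Torus.partialDeriv i w x‖ :=
    ⟨_, rfl⟩
  have hφc : Continuous φ := by
    rw [hφ]; exact continuous_finsetSum _ fun i _ => (hw.partialDeriv i).continuous.norm
  have hφ0 : ∀ x, 0 ≤ φ x := fun x => by rw [hφ]; exact Finset.sum_nonneg fun i _ => norm_nonneg _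
  have hφm : MemLp φ 2 volume :=
    hφc.memLp_of_hasCompactSupport (HasCompactSupport.of_compactSpace φ)
  have hw1 : IsContDiff 1 w := hw.isContDiff (by simp)
  -- pointwise bound
  have hpt : ∀ x, ‖⟪FunctionSpaces.Torus.convect w w x, G x⟫‖ ≤ W * (‖φ x‖ * ‖G x‖) := by
    intro x
    rw [Real.norm_eq_abs, Real.norm_of_nonneg (hφ0 x)]
    have h1 : ‖FunctionSpaces.Torus.convect w w x‖ ≤ ‖w x‖ * φ x := by
      rw [hφ]; exact norm_convect_le w hw1 x
    have h2 : ‖w x‖ * φ x ≤ W * φ x := mul_le_mul_of_nonneg_right (hW x) (hφ0 x)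
    calc |⟪FunctionSpaces.Torus.convect w w x, G x⟫| ≤ ‖FunctionSpaces.Torus.convect w w x‖ * ‖G x‖ :=
          abs_real_inner_le_norm _ _
      _ ≤ (W * φ x) * ‖G x‖ := mul_le_mul_of_nonneg_right (h1.trans h2) (norm_nonneg _)
      _ = W * (φ x * ‖G x‖) := by ring
  -- integrate
  obtain ⟨C, -, hC⟩ := exists_nonneg_forall_norm_le_of_continuous hφc
  have hint : Integrable (fun x => W * (‖φ x‖ * ‖G x‖)) volume := by
    refine Integrable.const_mul ?_ W
    have h1 : Integrable (fun x => φ x * ‖G x‖) volume :=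
      (hG.integrable one_le_two).norm.bdd_mul hφc.aestronglyMeasurable (ae_of_all _ hC)
    refine h1.congr (ae_of_all _ fun x => ?_)
    simp only [Real.norm_of_nonneg (hφ0 x)]
  have h1 : |∫ x, ⟪FunctionSpaces.Torus.convect w w x, G x⟫| ≤ W * ∫ x, ‖φ x‖ * ‖G x‖ := by
    rw [← Real.norm_eq_abs, ← integral_const_mul]
    exact norm_integral_le_of_norm_le hint (ae_of_all _ hpt)
  have h2 : ∫ x, ‖φ x‖ * ‖G x‖ ≤ (eLpNorm φ 2 volume).toReal * (eLpNorm G 2 volume).toReal :=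
    integral_norm_mul_norm_le_toReal_eLpNorm hφm hG
  -- `‖φ‖_{L²} ≤ (#d ‖∇w‖₂²)^{1/2}`
  have h3 : (eLpNorm φ 2 volume).toReal ≤ Real.sqrt (Fintype.card d * (eGradNormSq w).toReal) := by
    rw [hφm.eLpNorm_eq_integral_rpow_norm two_ne_zero ENNReal.ofNat_ne_top, ENNReal.toReal_ofNat,
      ENNReal.toReal_ofReal (by positivity), Real.sqrt_eq_rpow, ← one_div]
    refine Real.rpow_le_rpow (integral_nonneg fun x => by positivity) ?_ (by norm_num)
    have hsq : ∀ x, ‖φ x‖ ^ (2 : ℝ) ≤ (Fintype.card d : ℝ) * ∑ i, ‖FunctionSpaces.Torus.partialDeriv i w x‖ ^ 2 := by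
      intro x
      rw [Real.rpow_two, Real.norm_of_nonneg (hφ0 x), hφ]
      have h := sq_sum_le_card_mul_sum_sq (s := Finset.univ)
        (f := fun i => ‖FunctionSpaces.Torus.partialDeriv i w x‖)
      simpa only [Finset.card_univ] using h
    have hint2 : ∀ i, Integrable (fun x => ‖FunctionSpaces.Torus.partialDeriv i w x‖ ^ 2) volume := fun i =>
      ((hw.partialDeriv i).memLp 2).integrable_norm_pow two_ne_zero
    calc ∫ x, ‖φ x‖ ^ (2 : ℝ)
        ≤ ∫ x, (Fintype.card d : ℝ) * ∑ i, ‖FunctionSpaces.Torus.partialDeriv i w x‖ ^ 2 :=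
          integral_mono_of_nonneg (ae_of_all _ fun x => by positivity)
            ((integrable_finsetSum _ fun i _ => hint2 i).const_mul _) (ae_of_all _ hsq)
      _ = (Fintype.card d : ℝ) * (eGradNormSq w).toReal := by
          rw [integral_const_mul, integral_finsetSum _ fun i _ => hint2 i,
            sum_integral_norm_sq_partialDeriv_eq_toReal hw]
  calc |∫ x, ⟪FunctionSpaces.Torus.convect w w x, G x⟫| ≤ W * ∫ x, ‖φ x‖ * ‖G x‖ := h1
    _ ≤ W * ((eLpNorm φ 2 volume).toReal * (eLpNorm G 2 volume).toReal) := by gcongr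
    _ ≤ W * (Real.sqrt (Fintype.card d * (eGradNormSq w).toReal) * (eLpNorm G 2 volume).toReal) := by
        gcongr
    _ = _ := by ring

omit [Fintype d] in
/-- Products of norms of `L²` functions are integrable (`2‖f‖‖g‖ ≤ ‖f‖² + ‖g‖²`). [folklore] -/
theorem integrable_norm_mul_norm {X : Type*} {m : MeasurableSpace X} {μ : Measure X}
    {E₁ E₂ : Type*} [NormedAddCommGroup E₁] [NormedAddCommGroup E₂] {f : X → E₁} {g : X → E₂}
    (hf : MemLp f 2 μ) (hg : MemLp g 2 μ) : Integrable (fun x => ‖f x‖ * ‖g x‖) μ := by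
  refine Integrable.mono' (((hf.integrable_norm_pow two_ne_zero).const_mul 2⁻¹).add
    ((hg.integrable_norm_pow two_ne_zero).const_mul 2⁻¹)) (hf.1.norm.mul hg.1.norm)
    (ae_of_all _ fun x => ?_)
  rw [Real.norm_of_nonneg (mul_nonneg (norm_nonneg _) (norm_nonneg _))]
  simp only [Pi.add_apply]
  nlinarith [two_mul_le_add_sq ‖f x‖ ‖g x‖]

/-- **Continuity of the trilinear pairing in `L²` for a fixed smooth test field**: for
`a, b ∈ L²` and a smooth `Ψ` with `∑ᵢ‖∂ᵢΨ‖ ≤ D` pointwise,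
`|∫⟪a, (a·∇)Ψ⟫ - ∫⟪b, (b·∇)Ψ⟫| ≤ D ‖a - b‖_{L²} (‖a‖_{L²} + ‖b‖_{L²})`
(`⟪a,(a·∇)Ψ⟫ - ⟪b,(b·∇)Ψ⟫ = ⟪a - b, (a·∇)Ψ⟫ + ⟪b, ((a-b)·∇)Ψ⟫`). [folklore] -/
theorem abs_integral_inner_convect_sub_le {a b : UnitAddTorus d → EuclideanSpace ℝ d}
    (ha : MemLp a 2 volume) (hb : MemLp b 2 volume) {Ψ : UnitAddTorus d → EuclideanSpace ℝ d}
    (hΨ : IsSmooth Ψ) {D : ℝ} (hD : ∀ x, ∑ i, ‖FunctionSpaces.Torus.partialDeriv i Ψ x‖ ≤ D) :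
    |(∫ x, ⟪a x, FunctionSpaces.Torus.convect a Ψ x⟫) - ∫ x, ⟪b x, FunctionSpaces.Torus.convect b Ψ x⟫| ≤
      D * ((eLpNorm (a - b) 2 volume).toReal *
        ((eLpNorm a 2 volume).toReal + (eLpNorm b 2 volume).toReal)) := by
  have hD0 : 0 ≤ D := (Finset.sum_nonneg fun i _ => norm_nonneg _).trans (hD 0)
  have hΨ1 : IsContDiff 1 Ψ := hΨ.isContDiff (by simp)
  -- pointwise bound for the convective derivative, linear in the transporting field
  have hcv : ∀ (u : UnitAddTorus d → EuclideanSpace ℝ d) x, ‖FunctionSpaces.Torus.convect u Ψ x‖ ≤ D * ‖u x‖ := by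
    intro u x
    calc ‖FunctionSpaces.Torus.convect u Ψ x‖ ≤ ‖u x‖ * ∑ i, ‖FunctionSpaces.Torus.partialDeriv i Ψ x‖ := norm_convect_le u hΨ1 x
      _ ≤ ‖u x‖ * D := by gcongr; exact hD x
      _ = D * ‖u x‖ := mul_comm _ _
  have hlin : ∀ x, FunctionSpaces.Torus.convect a Ψ x - FunctionSpaces.Torus.convect b Ψ x = FunctionSpaces.Torus.convect (a - b) Ψ x := fun x => by
    simp only [FunctionSpaces.Torus.convect, Pi.sub_apply, map_sub]
  have hpt : ∀ x, ‖⟪a x, FunctionSpaces.Torus.convect a Ψ x⟫ - ⟪b x, FunctionSpaces.Torus.convect b Ψ x⟫‖ ≤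
      D * (‖(a - b) x‖ * ‖a x‖ + ‖(a - b) x‖ * ‖b x‖) := by
    intro x
    have hsplit : ⟪a x, FunctionSpaces.Torus.convect a Ψ x⟫ - ⟪b x, FunctionSpaces.Torus.convect b Ψ x⟫ =
        ⟪(a - b) x, FunctionSpaces.Torus.convect a Ψ x⟫ + ⟪b x, FunctionSpaces.Torus.convect (a - b) Ψ x⟫ := by
      rw [← hlin, Pi.sub_apply, inner_sub_left, inner_sub_right]
      ring
    rw [hsplit, Real.norm_eq_abs]
    refine (abs_add_le _ _).trans ?_
    have h1 : |⟪(a - b) x, FunctionSpaces.Torus.convect a Ψ x⟫| ≤ ‖(a - b) x‖ * (D * ‖a x‖) :=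
      (abs_real_inner_le_norm _ _).trans (mul_le_mul_of_nonneg_left (hcv a x) (norm_nonneg _))
    have h2 : |⟪b x, FunctionSpaces.Torus.convect (a - b) Ψ x⟫| ≤ ‖b x‖ * (D * ‖(a - b) x‖) :=
      (abs_real_inner_le_norm _ _).trans (mul_le_mul_of_nonneg_left (hcv (a - b) x) (norm_nonneg _))
    nlinarith
  have hint : Integrable (fun x => D * (‖(a - b) x‖ * ‖a x‖ + ‖(a - b) x‖ * ‖b x‖)) volume :=
    ((integrable_norm_mul_norm (ha.sub hb) ha).add (integrable_norm_mul_norm (ha.sub hb) hb)).const_mul D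
  rw [← integral_sub (integrable_inner_convect_self ha hΨ) (integrable_inner_convect_self hb hΨ),
    ← Real.norm_eq_abs]
  refine (norm_integral_le_of_norm_le hint (ae_of_all _ hpt)).trans ?_
  rw [integral_const_mul, integral_add (integrable_norm_mul_norm (ha.sub hb) ha)
    (integrable_norm_mul_norm (ha.sub hb) hb), mul_add (eLpNorm (a - b) 2 volume).toReal]
  gcongr
  · exact integral_norm_mul_norm_le_toReal_eLpNorm (ha.sub hb) ha
  · exact integral_norm_mul_norm_le_toReal_eLpNorm (ha.sub hb) hb

/-- **The truncations converge in the trilinear pairing**: for `v ∈ L²` and a smooth `Ψ`,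
`∫ ⟪P_M v, (P_M v·∇)Ψ⟫ → ∫ ⟪v, (v·∇)Ψ⟫` as `M → ∞` (`P_M v → v` in `L²`,
`Torus.tendsto_eLpNorm_fourierTruncate_sub`, and `abs_integral_inner_convect_sub_le` with
`‖P_M v‖_{L²} ≤ ‖v‖_{L²}`). [folklore] -/
theorem tendsto_integral_inner_fourierTruncate_convect {v : UnitAddTorus d → EuclideanSpace ℝ d}
    (hv : MemLp v 2 volume) {Ψ : UnitAddTorus d → EuclideanSpace ℝ d} (hΨ : IsSmooth Ψ) :
    Tendsto (fun M => ∫ x, ⟪fourierTruncate M v x, FunctionSpaces.Torus.convect (fourierTruncate M v) Ψ x⟫) atTop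
      (𝓝 (∫ x, ⟪v x, FunctionSpaces.Torus.convect v Ψ x⟫)) := by
  obtain ⟨D, -, hD⟩ := exists_sum_norm_partialDeriv_le hΨ
  have hP : ∀ M, MemLp (fourierTruncate M v) 2 volume := fun M => memLp_fourierTruncate M v 2
  -- `‖P_M v‖_{L²} ≤ ‖v‖_{L²}`
  have hPle : ∀ M, (eLpNorm (fourierTruncate M v) 2 volume).toReal ≤ (eLpNorm v 2 volume).toReal := by
    intro M
    refine ENNReal.toReal_mono hv.eLpNorm_ne_top ?_
    rw [eLpNorm_two_eq_rpow, eLpNorm_two_eq_rpow]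
    exact ENNReal.rpow_le_rpow (lintegral_enorm_sq_fourierTruncate_le hv M) (by norm_num)
  have hconv : Tendsto (fun M => (eLpNorm (fourierTruncate M v - v) 2 volume).toReal) atTop (𝓝 0) := by
    have h := tendsto_eLpNorm_fourierTruncate_sub hv
    rw [← ENNReal.toReal_zero]
    exact (ENNReal.tendsto_toReal ENNReal.zero_ne_top).comp h
  have hD0 : 0 ≤ D := (Finset.sum_nonneg fun i _ => norm_nonneg _).trans (hD 0)
  rw [tendsto_iff_norm_sub_tendsto_zero]
  have hbound : ∀ M, ‖(∫ x, ⟪fourierTruncate M v x, FunctionSpaces.Torus.convect (fourierTruncate M v) Ψ x⟫) -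
      ∫ x, ⟪v x, FunctionSpaces.Torus.convect v Ψ x⟫‖ ≤
      D * ((eLpNorm (fourierTruncate M v - v) 2 volume).toReal * (2 * (eLpNorm v 2 volume).toReal)) := by
    intro M
    rw [Real.norm_eq_abs]
    refine (abs_integral_inner_convect_sub_le (hP M) hv hΨ hD).trans ?_
    gcongr
    linarith [hPle M]
  refine squeeze_zero (fun M => norm_nonneg _) hbound ?_
  have : Tendsto (fun M => D * ((eLpNorm (fourierTruncate M v - v) 2 volume).toReal *
      (2 * (eLpNorm v 2 volume).toReal))) atTop (𝓝 (D * (0 * (2 * (eLpNorm v 2 volume).toReal)))) :=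
    (hconv.mul_const _).const_mul _
  simpa using this

end Trilinear

/-! ### Two dimensions: the trilinear term against the truncated Stokes operator vanishes -/

section TwoD

/-- Local notation for the flat unit two-torus `𝕋² = UnitAddTorus (Fin 2)`. -/
local notation "𝕋²" => UnitAddTorus (Fin 2)
/-- Local notation for velocity values `ℝ² = EuclideanSpace ℝ (Fin 2)`. -/
local notation "ℝ²" => EuclideanSpace ℝ (Fin 2)

/-- **The trilinear term of a truncation against the truncated Stokes operator, rewritten by
(A.62)**: for `v ∈ L²(𝕋²)` weakly divergence free and all `N`, `M`,
`∫ ⟪P_M v, (P_M v·∇) ΔP_N v⟫ = ∫ ⟪(P_M v·∇)P_M v, ΔP_M v - ΔP_N v⟫`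
(antisymmetry of the trilinear form for the smooth divergence-free `P_M v` and
`∫⟪ΔP_M v, (P_M v·∇)P_M v⟫ = 0`, Foias–Manley–Rosa–Temam 2001, (A.62)). [cite: FoiasManleyRosaTemam2001, App. II.A (A.62)] -/
theorem integral_inner_fourierTruncate_convect_laplacian_eq {v : 𝕋² → ℝ²} (hv : MemLp v 2 volume)
    (hdiv : FunctionSpaces.Torus.IsWeaklyDivFree v) (N M : ℕ) :
    ∫ x, ⟪fourierTruncate M v x, FunctionSpaces.Torus.convect (fourierTruncate M v) (laplacian (fourierTruncate N v)) x⟫ =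
      ∫ x, ⟪FunctionSpaces.Torus.convect (fourierTruncate M v) (fourierTruncate M v) x,
        laplacian (fourierTruncate M v) x - laplacian (fourierTruncate N v) x⟫ := by
  have hw : IsSmooth (fourierTruncate M v) := isSmooth_fourierTruncate M v
  have hwdiv : FunctionSpaces.Torus.IsDivFree (fourierTruncate M v) := isDivFree_fourierTruncate hv hdiv M
  have hN : IsSmooth (laplacian (fourierTruncate N v)) := (isSmooth_fourierTruncate N v).laplacian
  have hM : IsSmooth (laplacian (fourierTruncate M v)) := hw.laplacian
  -- antisymmetry
  have h1 : ∫ x, ⟪fourierTruncate M v x, FunctionSpaces.Torus.convect (fourierTruncate M v) (laplacian (fourierTruncate N v)) x⟫ =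
      -∫ x, ⟪FunctionSpaces.Torus.convect (fourierTruncate M v) (fourierTruncate M v) x, laplacian (fourierTruncate N v) x⟫ := by
    rw [integral_inner_convect_eq_neg hw hwdiv hw hN, neg_neg]
  -- (A.62) for the smooth divergence-free truncation
  have h2 : ∫ x, ⟪FunctionSpaces.Torus.convect (fourierTruncate M v) (fourierTruncate M v) x, laplacian (fourierTruncate M v) x⟫ = 0 := by
    have h := integral_inner_laplacian_convect_self_eq_zero hw hwdiv
    rw [← h]
    exact integral_congr_ae (ae_of_all _ fun x => real_inner_comm _ _)
  have hi1 : Integrable (fun x => ⟪FunctionSpaces.Torus.convect (fourierTruncate M v) (fourierTruncate M v) x, laplacian (fourierTruncate M v) x⟫) volume :=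
    ((hw.convect hw).inner hM).integrable
  have hi2 : Integrable (fun x => ⟪FunctionSpaces.Torus.convect (fourierTruncate M v) (fourierTruncate M v) x, laplacian (fourierTruncate N v) x⟫) volume :=
    ((hw.convect hw).inner hN).integrable
  rw [h1]
  simp_rw [inner_sub_right]
  rw [integral_sub hi1 hi2, h2, zero_sub]

/-- The `L²` norm of the difference of the Laplacians of two truncations, real form:
`‖ΔP_M v - ΔP_N v‖_{L²} ≤ (tail_N)^{1/2}` for `N ≤ M` (`tail_N < ∞`). [folklore] -/
theorem toReal_eLpNorm_laplacian_fourierTruncate_sub_le {d : Type*} [Fintype d] [DecidableEq d]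
    {v : UnitAddTorus d → EuclideanSpace ℝ d} (hv : Integrable v volume) {N M : ℕ} (hNM : N ≤ M)
    (htail : tailLaplacianNormSq N v ≠ ⊤) :
    (eLpNorm (fun x => laplacian (fourierTruncate M v) x - laplacian (fourierTruncate N v) x) 2 volume).toReal ≤
      Real.sqrt ((tailLaplacianNormSq N v).toReal) := by
  rw [eLpNorm_two_eq_rpow, Real.sqrt_eq_rpow, ← ENNReal.toReal_rpow]
  refine Real.rpow_le_rpow ENNReal.toReal_nonneg (ENNReal.toReal_mono htail
    (lintegral_enorm_sq_laplacian_fourierTruncate_sub hv hNM)) (by norm_num)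

/-- **The uniform bound for the truncations**: for `v ∈ L²(𝕋²)` weakly divergence free with
finite enstrophy and palinstrophy and `N ≤ M`,
`|∫⟪P_M v, (P_M v·∇) ΔP_N v⟫| ≤ (‖v̂(0)‖ + √Σ₄ (‖Δv‖₂²/16π⁴)^{1/2}) (2‖∇v‖₂²)^{1/2} (tail_N)^{1/2}`
(`integral_inner_fourierTruncate_convect_laplacian_eq`, `abs_integral_convect_self_inner_le`
with the sup bound `norm_fourierTruncate_apply_le`, `‖∇P_M v‖₂ ≤ ‖∇v‖₂`, and the tail bound). [cite: FoiasManleyRosaTemam2001, App. II.A (A.62)] -/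
theorem abs_integral_inner_fourierTruncate_convect_laplacian_le {v : 𝕋² → ℝ²} (hv : MemLp v 2 volume)
    (hdiv : FunctionSpaces.Torus.IsWeaklyDivFree v) (hgrad : eGradNormSq v ≠ ⊤) (hlap : eLaplacianNormSq v ≠ ⊤)
    {N M : ℕ} (hNM : N ≤ M) :
    |∫ x, ⟪fourierTruncate M v x, FunctionSpaces.Torus.convect (fourierTruncate M v) (laplacian (fourierTruncate N v)) x⟫| ≤
      (‖mFourierCoeff (EuclideanSpace.complexify ∘ v) 0‖ +
          Real.sqrt latticeSumFour * Real.sqrt ((eLaplacianNormSq v).toReal / (16 * Real.pi ^ 4))) *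
        Real.sqrt (2 * (eGradNormSq v).toReal) * Real.sqrt ((tailLaplacianNormSq N v).toReal) := by
  have hvi : Integrable v volume := hv.integrable one_le_two
  have hw : IsSmooth (fourierTruncate M v) := isSmooth_fourierTruncate M v
  have hG : MemLp (fun x => laplacian (fourierTruncate M v) x - laplacian (fourierTruncate N v) x) 2 volume :=
    (hw.laplacian.sub (isSmooth_fourierTruncate N v).laplacian).memLp 2
  rw [integral_inner_fourierTruncate_convect_laplacian_eq hv hdiv N M]
  refine (abs_integral_convect_self_inner_le hw hG (norm_fourierTruncate_apply_le hlap M)).trans ?_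
  have htail : tailLaplacianNormSq N v ≠ ⊤ := ne_top_of_le_ne_top hlap (tailLaplacianNormSq_le N v)
  have hK : 0 ≤ ‖mFourierCoeff (EuclideanSpace.complexify ∘ v) 0‖ +
      Real.sqrt latticeSumFour * Real.sqrt ((eLaplacianNormSq v).toReal / (16 * Real.pi ^ 4)) := by positivity
  have h1 : Real.sqrt (Fintype.card (Fin 2) * (eGradNormSq (fourierTruncate M v)).toReal) ≤
      Real.sqrt (2 * (eGradNormSq v).toReal) := by
    rw [Fintype.card_fin, Nat.cast_ofNat]
    exact Real.sqrt_le_sqrt (mul_le_mul_of_nonneg_left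
      (ENNReal.toReal_mono hgrad (eGradNormSq_fourierTruncate_le hvi M)) (by norm_num))
  have h2 := toReal_eLpNorm_laplacian_fourierTruncate_sub_le hvi hNM htail
  gcongr

/-- **The trilinear term against the truncated Stokes operator is small** (the 2-D cancellation
(A.62) for non-smooth `v ∈ D(A)`, quantitatively): for `v ∈ L²(𝕋²)` weakly divergence free
with `‖∇v‖₂, ‖Δv‖₂ < ∞` and every `N`,
`|∫⟪v, (v·∇) ΔP_N v⟫| ≤ (‖v̂(0)‖ + √Σ₄ (‖Δv‖₂²/16π⁴)^{1/2}) (2‖∇v‖₂²)^{1/2} (16π⁴∑_{|k|>N}|k|⁴‖v̂(k)‖²)^{1/2}`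
(the uniform bound for `P_M v`, `M ≥ N`, and `M → ∞`). [cite: FoiasManleyRosaTemam2001, App. II.A (A.62)] -/
theorem abs_integral_inner_convect_laplacian_fourierTruncate_le {v : 𝕋² → ℝ²} (hv : MemLp v 2 volume)
    (hdiv : FunctionSpaces.Torus.IsWeaklyDivFree v) (hgrad : eGradNormSq v ≠ ⊤) (hlap : eLaplacianNormSq v ≠ ⊤) (N : ℕ) :
    |∫ x, ⟪v x, FunctionSpaces.Torus.convect v (laplacian (fourierTruncate N v)) x⟫| ≤
      (‖mFourierCoeff (EuclideanSpace.complexify ∘ v) 0‖ +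
          Real.sqrt latticeSumFour * Real.sqrt ((eLaplacianNormSq v).toReal / (16 * Real.pi ^ 4))) *
        Real.sqrt (2 * (eGradNormSq v).toReal) * Real.sqrt ((tailLaplacianNormSq N v).toReal) := by
  have hlim := tendsto_integral_inner_fourierTruncate_convect hv (isSmooth_fourierTruncate N v).laplacian
  refine le_of_tendsto ((continuous_abs.tendsto _).comp hlim) ?_
  filter_upwards [eventually_ge_atTop N] with M hM
  exact abs_integral_inner_fourierTruncate_convect_laplacian_le hv hdiv hgrad hlap hM

/-- **… and tends to zero as `N → ∞`** (the tail of the convergent series `∑|k|⁴‖v̂(k)‖²`). [cite: FoiasManleyRosaTemam2001, App. II.A (A.62)] -/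
theorem tendsto_integral_inner_convect_laplacian_fourierTruncate {v : 𝕋² → ℝ²} (hv : MemLp v 2 volume)
    (hdiv : FunctionSpaces.Torus.IsWeaklyDivFree v) (hgrad : eGradNormSq v ≠ ⊤) (hlap : eLaplacianNormSq v ≠ ⊤) :
    Tendsto (fun N => ∫ x, ⟪v x, FunctionSpaces.Torus.convect v (laplacian (fourierTruncate N v)) x⟫) atTop (𝓝 0) := by
  set K : ℝ := (‖mFourierCoeff (EuclideanSpace.complexify ∘ v) 0‖ +
      Real.sqrt latticeSumFour * Real.sqrt ((eLaplacianNormSq v).toReal / (16 * Real.pi ^ 4))) *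
    Real.sqrt (2 * (eGradNormSq v).toReal) with hK
  have htail : Tendsto (fun N => Real.sqrt ((tailLaplacianNormSq N v).toReal)) atTop (𝓝 0) := by
    have h1 : Tendsto (fun N => (tailLaplacianNormSq N v).toReal) atTop (𝓝 0) := by
      rw [← ENNReal.toReal_zero]
      exact (ENNReal.tendsto_toReal ENNReal.zero_ne_top).comp (tendsto_tailLaplacianNormSq hlap)
    have h2 := (Real.continuous_sqrt.tendsto 0).comp h1
    rwa [Function.comp_def, Real.sqrt_zero] at h2
  refine squeeze_zero_norm (fun N => ?_) (by simpa using htail.const_mul K)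
  rw [Real.norm_eq_abs]
  exact abs_integral_inner_convect_laplacian_fourierTruncate_le hv hdiv hgrad hlap N

end TwoD

end Literature.Analysis.FluidPDE.Torus
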